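import Summits.Ventures.LatticeQCDFlow.Exactness.IMHCommonRandomNumbersMeetingTimeAnyCouplingAtoms
import HarnessLib

/-!
# The coupling survives unbounded weights (any value of `A`): `1/A(x) ≤ max(1, w(x))/E_q[min(1, w)]`, so two runs on one stream of
# random numbers disagree in expectation at most `E[max(1, w(X_0), w(X′_0)); X_0 ≠ X′_0]/E_q[min(1, w)]` rounds — no mode, no `W`

HONEST FRAMING: exact (Metropolis-corrected) sampling algorithms for lattice gauge theory;
figures of merit are autocorrelation/cost numbers at stated couplings and volumes; no
continuum-physics claim.

Venture `LatticeQCDFlow` (cell pub-lqcd), topic `Exactness`; FANOUT row 30 (lean-1, GEN-40).  NEW WORK of the cell (standard Borel `Ω`,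
`MeasurableEq Ω`; EVERY proposal law — atoms allowed, via this generation's `…AnyCouplingAtoms`); sequel to GEN-39's `Exactness/IMHCommonRandomNumbersMeetingTimeAnyCoupling` (EVERY coupling:
`Σ_n P(X_n ≠ X′_n) = E[1/A(heavier start); X_0 ≠ X′_0]` in `ℝ≥0∞`, proved WITHOUT a bound on the weight).  Every earlier meeting-time
BOUND of the programme (GEN-36–39) assumed a normalised weight `w ≤ W = w(x₀)` (a mode; uniform ergodicity, `A = 1/W > 0`) — the
«any value of `A`» item of their NOT CLAIMED lists.  For a trained flow at large volume the weight `w = e^{−ΔS}` is heavy-tailed and has no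
useful supremum.  Here NO BOUND ON `w` IS ASSUMED (exact sampler `K = indepMH q w`, `0 < w` measurable, `q` a probability measure;
`A(x) = imhAcceptMass q w x = ∫ min(1, w(y)/w(x)) q(dy)`; CRN pair kernel `K̂`; `c₁ = E_q[min(1, w)] = ∫ min(1, w) dq ∈ (0, 1]`):

* §1 **`ofReal_mul_imhAcceptMass`** — `w(x)·A(x) = ∫ min(w(x), w(y)) q(dy)`; **`lintegral_min_one_le_imhAcceptMass_mul`** — `c₁ ≤ A(x)·max(1, w(x))`; **`inv_imhAcceptMass_le`** — THE ACCEPTANCE FROM `x` IS AT LEAST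
  `c₁/max(1, w(x))`: `1/A(x) ≤ max(1, w(x))/c₁` (in `ℝ≥0∞`) — the holding time at `x` is at most linear in the weight `w(x)`, with a
  MODEL constant `c₁`, whatever the tail of `w`.
* §2 **`tsum_offDiagonal_le_unboundedWeights`** — from EVERY initial coupling `μ̂₀`:
  `Σ_n (μ̂₀K̂ⁿ)(Δᶜ) ≤ (∫_{Δᶜ} max(1, w(p.1), w(p.2)) dμ̂₀)/c₁`; **`crn_chain_lintegral_totalDisagreement_le_unboundedWeights`** — the same
  for the expected total disagreement time `E[T] = E[#{n : X_n ≠ X′_n}]` read on the pair path law (Tonelli).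
* §3 **`tendsto_offDiagonal_of_lintegral_ne_top`** — if `∫_{Δᶜ} max(1, w(p.1), w(p.2)) dμ̂₀ < ∞` (e.g. both starting laws integrate `w`)
  then `P(X_n ≠ X′_n) → 0`: THE TWO RUNS MERGE, and the exactly unbiased coupled estimator has finite expected cost, for EVERY weight with
  `E_{μ̂₀}[w] < ∞` — in particular from a start `y ∼ q` one needs `∫ w dq = 1` only, and from the target `∫ w dπ = ∫ w² dq < ∞`
  (**`lintegral_max_one_le`** [bookkeeping]: `∫ max(1, w(p.1), w(p.2)) ≤ 1 + ∫ w∘fst + ∫ w∘snd`).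
* §4 **`setLIntegral_compl_singleton_indepMH_le`** — `∫_{y ≠ x} g dK(x, ·) ≤ ∫ g dq`; **`lintegral_weight_indepMH_le`** — `∫ w dK(x, ·) ≤ 1 + w(x)`;
  **`lintegral_offDiagonal_detLag_le`** — `∫_{Δᶜ} max(1, w, w′) dν̂_x ≤ max(1, w(x)) + 1`;
  **`crn_chain_lintegral_totalDisagreement_le_detLag_unboundedWeights`** — THE PRACTICAL START (production run at `x`, leading run one update
  ahead, `ν̂_x = K(x, ·) ⊗ δ_x`): `E[#{n : X_n ≠ X′_n}] ≤ (max(1, w(x)) + 1)/c₁` — FINITE FROM EVERY START FOR EVERY POSITIVE NORMALISED WEIGHT, NO MOMENT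
  CONDITION AT ALL (the runs differ at time `0` only if the leading run moved, and the moved mass lies below the model `q`).
Reading (gauge files): for the flow-driven exact gauge sampler with an UNBOUNDED importance weight, two coupled runs still merge in
expected time at most `(1 + E w(U_0) + E w(U′_0))/E_q[min(1, w)]` — linear in the starting weights, no uniform acceptance floor needed —
and from a fixed configuration `U` with the leading run one update ahead in at most `(max(1, w(U)) + 1)/E_q[min(1, w)]` rounds, whatever `w`.
NOT CLAIMED: the geometric RATE (there is none without a weight bound); the unbiasedness ∕ variance files of GEN-36–39 without `W`
(their dominated-convergence steps use `W`); a lower bound.  No `sorry`, no new definitions, nothing cited as a fact.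
-/

noncomputable section

namespace Summit.Ventures.LatticeQCDFlow.Exactness

open MeasureTheory ProbabilityTheory Function Finset Filter Set
open scoped _root_.ENNReal unitInterval Topology
open Summit.Ventures.LatticeQCDFlow.Scoring

variable {Ω : Type*} [MeasurableSpace Ω] {q : Measure Ω} [IsProbabilityMeasure q] {w : Ω → ℝ}

/-! ## §1 The acceptance from `x` is at least `E_q[min(1, w)]/max(1, w(x))` -/

omit [IsProbabilityMeasure q] in
/-- `w(x)·A(x) = ∫ min(w(x), w(y)) q(dy)` (the detailed-balance form of the acceptance mass). [ours, bookkeeping] -/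
theorem ofReal_mul_imhAcceptMass (hw0 : ∀ y, 0 < w y) (x : Ω) :
    ENNReal.ofReal (w x) * imhAcceptMass q w x = ∫⁻ y, ENNReal.ofReal (min (w x) (w y)) ∂q := by
  unfold imhAcceptMass
  rw [← lintegral_const_mul' _ _ ENNReal.ofReal_ne_top]
  exact lintegral_congr fun y => ofReal_mul_imhAcceptE hw0 x y

omit [IsProbabilityMeasure q] in
/-- **`E_q[min(1, w)] ≤ A(x)·max(1, w(x))`**. [ours] -/
theorem lintegral_min_one_le_imhAcceptMass_mul (hw0 : ∀ y, 0 < w y) (x : Ω) :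
    ∫⁻ y, ENNReal.ofReal (min 1 (w y)) ∂q ≤ imhAcceptMass q w x * ENNReal.ofReal (max 1 (w x)) := by
  -- `min(1, w x)·c₁ ≤ ∫ min(w x, w y) = w(x)·A(x) = min(1, w x)·max(1, w x)·A(x)`
  have hmm : min 1 (w x) * max 1 (w x) = w x := by
    rcases le_total (w x) 1 with h | h
    · rw [min_eq_right h, max_eq_left h, mul_one]
    · rw [min_eq_left h, max_eq_right h, one_mul]
  have hm0 : 0 < min 1 (w x) := lt_min one_pos (hw0 x)
  -- `min(1, a)·min(1, b) ≤ min(a, b)` for `a, b ≥ 0` (the tree's `Scaling.min_one_mul_min_one_le_min`, restated locally to keep the import light)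
  have hmin : ∀ {a b : ℝ}, 0 ≤ a → 0 ≤ b → min 1 a * min 1 b ≤ min a b := by
    intro a b ha hb
    rcases le_total a 1 with ha1 | ha1 <;> rcases le_total b 1 with hb1 | hb1
    · rw [min_eq_right ha1, min_eq_right hb1]
      exact le_min (mul_le_of_le_one_right ha hb1) (mul_le_of_le_one_left hb ha1)
    · rw [min_eq_right ha1, min_eq_left hb1, mul_one]
      exact le_min le_rfl (ha1.trans hb1)
    · rw [min_eq_left ha1, min_eq_right hb1, one_mul]
      exact le_min (hb1.trans ha1) le_rfl
    · rw [min_eq_left ha1, min_eq_left hb1, one_mul]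
      exact le_min ha1 hb1
  have hwx : ENNReal.ofReal (w x) = ENNReal.ofReal (min 1 (w x)) * ENNReal.ofReal (max 1 (w x)) := by
    rw [← ENNReal.ofReal_mul hm0.le, hmm]
  have h1 : ENNReal.ofReal (min 1 (w x)) * ∫⁻ y, ENNReal.ofReal (min 1 (w y)) ∂q ≤
      ENNReal.ofReal (min 1 (w x)) * (imhAcceptMass q w x * ENNReal.ofReal (max 1 (w x))) := by
    calc ENNReal.ofReal (min 1 (w x)) * ∫⁻ y, ENNReal.ofReal (min 1 (w y)) ∂q
        = ∫⁻ y, ENNReal.ofReal (min 1 (w x) * min 1 (w y)) ∂q := by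
          rw [← lintegral_const_mul' _ _ ENNReal.ofReal_ne_top]
          exact lintegral_congr fun y => (ENNReal.ofReal_mul hm0.le).symm
      _ ≤ ∫⁻ y, ENNReal.ofReal (min (w x) (w y)) ∂q :=
          lintegral_mono fun y => ENNReal.ofReal_le_ofReal (hmin (hw0 x).le (hw0 y).le)
      _ = ENNReal.ofReal (w x) * imhAcceptMass q w x := (ofReal_mul_imhAcceptMass hw0 x).symm
      _ = ENNReal.ofReal (min 1 (w x)) * (imhAcceptMass q w x * ENNReal.ofReal (max 1 (w x))) := by
          rw [hwx]; ring
  exact (ENNReal.mul_le_mul_iff_right ((ENNReal.ofReal_pos.2 hm0).ne') ENNReal.ofReal_ne_top).1 h1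

/-- **THE HOLDING TIME AT `x` IS AT MOST LINEAR IN THE WEIGHT**: `1/A(x) ≤ max(1, w(x))/E_q[min(1, w)]` (`ℝ≥0∞`). [ours] -/
theorem inv_imhAcceptMass_le (hw0 : ∀ y, 0 < w y) (x : Ω) :
    (imhAcceptMass q w x)⁻¹ ≤ ENNReal.ofReal (max 1 (w x)) / ∫⁻ y, ENNReal.ofReal (min 1 (w y)) ∂q := by
  set c := ∫⁻ y, ENNReal.ofReal (min 1 (w y)) ∂q with hc
  set M := ENNReal.ofReal (max 1 (w x)) with hM
  set A := imhAcceptMass q w x with hA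
  have hM0 : M ≠ 0 := (ENNReal.ofReal_pos.2 (lt_of_lt_of_le one_pos (le_max_left _ _))).ne'
  have hle : c ≤ A * M := lintegral_min_one_le_imhAcceptMass_mul hw0 x
  have hAtop : A ≠ ∞ := ne_top_of_le_ne_top ENNReal.one_ne_top (imhAcceptMass_le_one q w x)
  rw [ENNReal.le_div_iff_mul_le (Or.inr hM0) (Or.inr ENNReal.ofReal_ne_top)]
  rcases eq_or_ne A 0 with hA0 | hA0
  · have hc0 : c = 0 := le_antisymm (by simpa [hA0] using hle) bot_le
    rw [hc0, mul_zero]; exact bot_le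
  · calc A⁻¹ * c ≤ A⁻¹ * (A * M) := by gcongr
      _ = M := by rw [← mul_assoc, ENNReal.inv_mul_cancel hA0 hAtop, one_mul]

/-! ## §2 The expected total disagreement time from any coupling, without a weight bound -/

omit [MeasurableSpace Ω] [IsProbabilityMeasure q] in
/-- `max(1, w(p.1)) ≤ max(1, w(p.1), w(p.2))` and its mirror, in `ℝ≥0∞`. [bookkeeping] -/
theorem ofReal_max_one_le_fst_snd (p : Ω × Ω) :
    ENNReal.ofReal (max 1 (w p.1)) ≤ ENNReal.ofReal (max 1 (max (w p.1) (w p.2))) ∧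
      ENNReal.ofReal (max 1 (w p.2)) ≤ ENNReal.ofReal (max 1 (max (w p.1) (w p.2))) :=
  ⟨ENNReal.ofReal_le_ofReal (max_le_max le_rfl (le_max_left _ _)),
    ENNReal.ofReal_le_ofReal (max_le_max le_rfl (le_max_right _ _))⟩

/-- **`Σ_n (μ̂₀K̂ⁿ)(Δᶜ) ≤ (∫_{Δᶜ} max(1, w(p.1), w(p.2)) dμ̂₀)/E_q[min(1, w)]`** from EVERY initial coupling (standard Borel `Ω`; no bound on `w`, every `q`). [ours] -/
theorem tsum_offDiagonal_le_unboundedWeights [StandardBorelSpace Ω] [Nonempty Ω] [MeasurableSingletonClass Ω] [MeasurableEq Ω]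
    (hw : Measurable w) (hw0 : ∀ y, 0 < w y) (Khat : Kernel (Ω × Ω) (Ω × Ω)) [IsMarkovKernel Khat]
    (hK : ∀ z : Ω × Ω, Khat z = (q.prod (volume : Measure unitInterval)).map (fun p : Ω × unitInterval =>
      ((if (p.2 : ℝ) * w z.1 ≤ w p.1 then p.1 else z.1), (if (p.2 : ℝ) * w z.2 ≤ w p.1 then p.1 else z.2))))
    (μ₀ : Measure (Ω × Ω)) [IsFiniteMeasure μ₀] :
    ∑' n, ((fun m : Measure (Ω × Ω) => m.bind Khat)^[n] μ₀) (Set.diagonal Ω)ᶜ ≤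
      (∫⁻ p in (Set.diagonal Ω)ᶜ, ENNReal.ofReal (max 1 (max (w p.1) (w p.2))) ∂μ₀) /
        ∫⁻ y, ENNReal.ofReal (min 1 (w y)) ∂q := by
  set c := ∫⁻ y, ENNReal.ofReal (min 1 (w y)) ∂q with hc
  set G : Ω × Ω → ℝ≥0∞ := fun p => ENNReal.ofReal (max 1 (max (w p.1) (w p.2))) with hG
  have hGm : Measurable G := (measurable_const.max ((hw.comp measurable_fst).max (hw.comp measurable_snd))).ennreal_ofReal
  have hD : MeasurableSet (Set.diagonal Ω) := measurableSet_diagonal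
  have hOm : MeasurableSet {p : Ω × Ω | w p.2 ≤ w p.1} := measurableSet_le (hw.comp measurable_snd) (hw.comp measurable_fst)
  rw [tsum_iterate_bind_crnPair_offDiagonal_eq_anyCoupling_atoms hw hw0 Khat hK μ₀]
  have h1 : ∫⁻ p in {p : Ω × Ω | w p.2 ≤ w p.1} ∩ (Set.diagonal Ω)ᶜ, (imhAcceptMass q w p.1)⁻¹ ∂μ₀ ≤
      ∫⁻ p in {p : Ω × Ω | w p.2 ≤ w p.1} ∩ (Set.diagonal Ω)ᶜ, G p / c ∂μ₀ :=
    lintegral_mono fun p => (inv_imhAcceptMass_le hw0 p.1).trans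
      (ENNReal.div_le_div_right (ofReal_max_one_le_fst_snd p).1 _)
  have h2 : ∫⁻ p in {p : Ω × Ω | w p.2 ≤ w p.1}ᶜ ∩ (Set.diagonal Ω)ᶜ, (imhAcceptMass q w p.2)⁻¹ ∂μ₀ ≤
      ∫⁻ p in {p : Ω × Ω | w p.2 ≤ w p.1}ᶜ ∩ (Set.diagonal Ω)ᶜ, G p / c ∂μ₀ :=
    lintegral_mono fun p => (inv_imhAcceptMass_le hw0 p.2).trans
      (ENNReal.div_le_div_right (ofReal_max_one_le_fst_snd p).2 _)
  have hunion : {p : Ω × Ω | w p.2 ≤ w p.1} ∩ (Set.diagonal Ω)ᶜ ∪ {p : Ω × Ω | w p.2 ≤ w p.1}ᶜ ∩ (Set.diagonal Ω)ᶜ =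
      (Set.diagonal Ω)ᶜ := by
    rw [← Set.union_inter_distrib_right, Set.union_compl_self, Set.univ_inter]
  have hdisj : Disjoint ({p : Ω × Ω | w p.2 ≤ w p.1} ∩ (Set.diagonal Ω)ᶜ) ({p : Ω × Ω | w p.2 ≤ w p.1}ᶜ ∩ (Set.diagonal Ω)ᶜ) :=
    (disjoint_compl_right.inter_left _).inter_right _
  calc ∫⁻ p in {p : Ω × Ω | w p.2 ≤ w p.1} ∩ (Set.diagonal Ω)ᶜ, (imhAcceptMass q w p.1)⁻¹ ∂μ₀ +
        ∫⁻ p in {p : Ω × Ω | w p.2 ≤ w p.1}ᶜ ∩ (Set.diagonal Ω)ᶜ, (imhAcceptMass q w p.2)⁻¹ ∂μ₀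
      ≤ ∫⁻ p in {p : Ω × Ω | w p.2 ≤ w p.1} ∩ (Set.diagonal Ω)ᶜ, G p / c ∂μ₀ +
          ∫⁻ p in {p : Ω × Ω | w p.2 ≤ w p.1}ᶜ ∩ (Set.diagonal Ω)ᶜ, G p / c ∂μ₀ := add_le_add h1 h2
    _ = ∫⁻ p in (Set.diagonal Ω)ᶜ, G p / c ∂μ₀ := by
        rw [← lintegral_union (hOm.compl.inter hD.compl) hdisj, hunion]
    _ = (∫⁻ p in (Set.diagonal Ω)ᶜ, G p ∂μ₀) / c := by
        simp only [div_eq_mul_inv]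
        rw [lintegral_mul_const _ hGm]

/-- The time-`n` disagreement probability on the pair path law equals `(μ̂₀K̂ⁿ)(Δᶜ)` (in `ℝ≥0∞`). [ours, bookkeeping] -/
theorem crn_chain_offDiagonal_eq [MeasurableEq Ω] (Khat : Kernel (Ω × Ω) (Ω × Ω)) [IsMarkovKernel Khat]
    (μ₀ : Measure (Ω × Ω)) [IsProbabilityMeasure μ₀] (n : ℕ) :
    (Kernel.trajMeasure (X := fun _ : ℕ => Ω × Ω) μ₀
        (fun n : ℕ => Khat.comap (fun h : (i : ↥(Finset.Iic n)) → Ω × Ω => h ⟨n, Finset.mem_Iic.2 le_rfl⟩)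
          (measurable_pi_apply _))) {z | z n ∉ Set.diagonal Ω} =
      ((fun m : Measure (Ω × Ω) => m.bind Khat)^[n] μ₀) (Set.diagonal Ω)ᶜ := by
  have hD : MeasurableSet (Set.diagonal Ω) := measurableSet_diagonal
  rw [← chain_map_eval Khat μ₀ n, Measure.map_apply (measurable_pi_apply n) hD.compl]
  rfl

/-- **THE EXPECTED TOTAL DISAGREEMENT TIME WITHOUT A WEIGHT BOUND**: from every initial coupling,
`E[#{n : X_n ≠ X′_n}] ≤ (∫_{Δᶜ} max(1, w(p.1), w(p.2)) dμ̂₀)/E_q[min(1, w)]` (`ℝ≥0∞`; Tonelli on the pair path law). [ours] -/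
theorem crn_chain_lintegral_totalDisagreement_le_unboundedWeights [StandardBorelSpace Ω] [Nonempty Ω] [MeasurableSingletonClass Ω]
    [MeasurableEq Ω] (hw : Measurable w) (hw0 : ∀ y, 0 < w y)
    (Khat : Kernel (Ω × Ω) (Ω × Ω)) [IsMarkovKernel Khat]
    (hK : ∀ z : Ω × Ω, Khat z = (q.prod (volume : Measure unitInterval)).map (fun p : Ω × unitInterval =>
      ((if (p.2 : ℝ) * w z.1 ≤ w p.1 then p.1 else z.1), (if (p.2 : ℝ) * w z.2 ≤ w p.1 then p.1 else z.2))))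
    (μ₀ : Measure (Ω × Ω)) [IsProbabilityMeasure μ₀] :
    ∫⁻ z, (∑' n, (Set.diagonal Ω)ᶜ.indicator (1 : Ω × Ω → ℝ≥0∞) (z n))
        ∂(Kernel.trajMeasure (X := fun _ : ℕ => Ω × Ω) μ₀
          (fun n : ℕ => Khat.comap (fun h : (i : ↥(Finset.Iic n)) → Ω × Ω => h ⟨n, Finset.mem_Iic.2 le_rfl⟩)
            (measurable_pi_apply _))) ≤
      (∫⁻ p in (Set.diagonal Ω)ᶜ, ENNReal.ofReal (max 1 (max (w p.1) (w p.2))) ∂μ₀) /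
        ∫⁻ y, ENNReal.ofReal (min 1 (w y)) ∂q := by
  have hD : MeasurableSet (Set.diagonal Ω) := measurableSet_diagonal
  have hIm : ∀ n, Measurable fun z : ℕ → Ω × Ω => (Set.diagonal Ω)ᶜ.indicator (1 : Ω × Ω → ℝ≥0∞) (z n) := fun n =>
    (measurable_one.indicator hD.compl).comp (measurable_pi_apply n)
  rw [lintegral_tsum fun n => (hIm n).aemeasurable]
  refine le_trans (le_of_eq (tsum_congr fun n => ?_)) (tsum_offDiagonal_le_unboundedWeights hw hw0 Khat hK μ₀)
  rw [← crn_chain_offDiagonal_eq Khat μ₀ n]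
  have hset : {z : ℕ → Ω × Ω | z n ∉ Set.diagonal Ω} = (fun z : ℕ → Ω × Ω => z n) ⁻¹' (Set.diagonal Ω)ᶜ := rfl
  rw [hset, ← lintegral_indicator_one ((measurable_pi_apply n) hD.compl)]
  rfl

/-! ## §3 Merging without a weight bound -/

/-- **THE RUNS MERGE WHENEVER THE STARTING WEIGHTS ARE INTEGRABLE**: if `∫_{Δᶜ} max(1, w(p.1), w(p.2)) dμ̂₀ < ∞` then
`P(X_n ≠ X′_n) → 0` (the series of §2 converges). [ours] -/
theorem tendsto_offDiagonal_of_lintegral_ne_top [StandardBorelSpace Ω] [Nonempty Ω] [MeasurableSingletonClass Ω] [MeasurableEq Ω]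
    (hw : Measurable w) (hw0 : ∀ y, 0 < w y) (Khat : Kernel (Ω × Ω) (Ω × Ω)) [IsMarkovKernel Khat]
    (hK : ∀ z : Ω × Ω, Khat z = (q.prod (volume : Measure unitInterval)).map (fun p : Ω × unitInterval =>
      ((if (p.2 : ℝ) * w z.1 ≤ w p.1 then p.1 else z.1), (if (p.2 : ℝ) * w z.2 ≤ w p.1 then p.1 else z.2))))
    (μ₀ : Measure (Ω × Ω)) [IsFiniteMeasure μ₀]
    (hfin : ∫⁻ p in (Set.diagonal Ω)ᶜ, ENNReal.ofReal (max 1 (max (w p.1) (w p.2))) ∂μ₀ ≠ ∞) :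
    Tendsto (fun n => ((fun m : Measure (Ω × Ω) => m.bind Khat)^[n] μ₀) (Set.diagonal Ω)ᶜ) atTop (𝓝 0) := by
  have hc0 : ∫⁻ y, ENNReal.ofReal (min 1 (w y)) ∂q ≠ 0 := by
    intro h0
    have hae : (fun y => ENNReal.ofReal (min 1 (w y))) =ᵐ[q] 0 :=
      (lintegral_eq_zero_iff (measurable_const.min hw).ennreal_ofReal).1 h0
    have hfalse : ∀ᵐ y ∂q, False := hae.mono fun y hy => by
      have hpos : 0 < ENNReal.ofReal (min 1 (w y)) := ENNReal.ofReal_pos.2 (lt_min one_pos (hw0 y))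
      simp only [Pi.zero_apply] at hy
      exact hpos.ne' hy
    rw [ae_iff] at hfalse
    simp at hfalse
  refine ENNReal.tendsto_atTop_zero_of_tsum_ne_top (ne_top_of_le_ne_top ?_ (tsum_offDiagonal_le_unboundedWeights hw hw0 Khat hK μ₀))
  exact ENNReal.div_ne_top hfin hc0

omit [IsProbabilityMeasure q] in
/-- **Bookkeeping for product-type starts**: `∫_{Δᶜ} max(1, w(p.1), w(p.2)) dμ̂₀ ≤ μ̂₀(Ω×Ω) + ∫ w∘fst dμ̂₀ + ∫ w∘snd dμ̂₀` — finite as soon as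
both starting laws integrate the weight. [ours] -/
theorem lintegral_max_one_le (hw : Measurable w) (hw0 : ∀ y, 0 < w y) (μ₀ : Measure (Ω × Ω)) :
    ∫⁻ p in (Set.diagonal Ω)ᶜ, ENNReal.ofReal (max 1 (max (w p.1) (w p.2))) ∂μ₀ ≤
      μ₀ Set.univ + ∫⁻ p, ENNReal.ofReal (w p.1) ∂μ₀ + ∫⁻ p, ENNReal.ofReal (w p.2) ∂μ₀ := by
  have hpt : ∀ p : Ω × Ω, ENNReal.ofReal (max 1 (max (w p.1) (w p.2))) ≤
      1 + ENNReal.ofReal (w p.1) + ENNReal.ofReal (w p.2) := fun p => by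
    rw [← ENNReal.ofReal_one, ← ENNReal.ofReal_add zero_le_one (hw0 _).le,
      ← ENNReal.ofReal_add (add_nonneg zero_le_one (hw0 _).le) (hw0 _).le]
    refine ENNReal.ofReal_le_ofReal (max_le ?_ (max_le ?_ ?_)) <;> linarith [hw0 p.1, hw0 p.2]
  calc ∫⁻ p in (Set.diagonal Ω)ᶜ, ENNReal.ofReal (max 1 (max (w p.1) (w p.2))) ∂μ₀
      ≤ ∫⁻ p, ENNReal.ofReal (max 1 (max (w p.1) (w p.2))) ∂μ₀ := setLIntegral_le_lintegral _ _
    _ ≤ ∫⁻ p, (1 + ENNReal.ofReal (w p.1) + ENNReal.ofReal (w p.2)) ∂μ₀ := lintegral_mono hpt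
    _ = μ₀ Set.univ + ∫⁻ p, ENNReal.ofReal (w p.1) ∂μ₀ + ∫⁻ p, ENNReal.ofReal (w p.2) ∂μ₀ := by
        have m1 : Measurable fun p : Ω × Ω => ENNReal.ofReal (w p.1) := (hw.comp measurable_fst).ennreal_ofReal
        have m2 : Measurable fun p : Ω × Ω => ENNReal.ofReal (w p.2) := (hw.comp measurable_snd).ennreal_ofReal
        rw [lintegral_add_right (fun p : Ω × Ω => 1 + ENNReal.ofReal (w p.1)) m2,
          lintegral_add_right (fun _ : Ω × Ω => (1 : ℝ≥0∞)) m1, lintegral_const, one_mul]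

/-! ## §4 The practical start: production run at `x`, leading run one update ahead — no moment condition at all -/

/-- **OFF THE CURRENT POINT, ONE STEP OF THE KERNEL IS BELOW THE MODEL**: for measurable `g ≥ 0`,
`∫_{y ≠ x} g(y) K(x, dy) ≤ ∫ g dq` (the moved mass has density `a(x, ·) ≤ 1` against `q`; the rejected mass sits AT `x`). [ours] -/
theorem setLIntegral_compl_singleton_indepMH_le [MeasurableSingletonClass Ω] (hw : Measurable w) (x : Ω) {g : Ω → ℝ≥0∞}
    (hg : Measurable g) : ∫⁻ y in {x}ᶜ, g y ∂(indepMH q w x) ≤ ∫⁻ y, g y ∂q := by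
  haveI : Fact (Measurable w) := ⟨hw⟩
  have hgi : Measurable fun y => ({x}ᶜ : Set Ω).indicator g y := hg.indicator (measurableSet_singleton x).compl
  -- one step of the kernel: `∫ h dK(x, ·) = ∫ a(x, y) h(y) q(dy) + (1 − A(x)) h(x)` (as in row 13's `lintegral_indepMH`, unfolded here)
  have hstep : ∫⁻ y, ({x}ᶜ : Set Ω).indicator g y ∂(indepMH q w x) =
      ∫⁻ y, imhAcceptE w x y * ({x}ᶜ : Set Ω).indicator g y ∂q + (1 - imhAcceptMass q w x) * ({x}ᶜ : Set Ω).indicator g x := by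
    have h2 : Measurable (Function.uncurry fun (x : Ω) (_ : Ω) => 1 - imhAcceptMass q w x) :=
      measurable_const.sub ((measurable_imhAcceptMass q hw).comp measurable_fst)
    rw [indepMH, Kernel.add_apply, lintegral_add_measure,
      Kernel.withDensity_apply _ (measurable_imhAcceptE hw), Kernel.const_apply,
      lintegral_withDensity_eq_lintegral_mul _ (measurable_imhAcceptE hw).of_uncurry_left hgi,
      Kernel.withDensity_apply _ h2, Kernel.deterministic_apply, id, withDensity_const,
      lintegral_smul_measure, lintegral_dirac' _ hgi, smul_eq_mul]
    rfl
  rw [← lintegral_indicator (measurableSet_singleton x).compl, hstep, Set.indicator_of_notMem (by simp : x ∉ ({x}ᶜ : Set Ω)),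
    mul_zero, add_zero]
  refine lintegral_mono fun y => ?_
  calc imhAcceptE w x y * ({x}ᶜ : Set Ω).indicator g y ≤ 1 * g y :=
        mul_le_mul' (imhAcceptE_le_one w x y) (Set.indicator_le_self ({x}ᶜ : Set Ω) g y)
    _ = g y := one_mul _

/-- **One step from `x` integrates the weight without any moment condition**: `∫ w dK(x, ·) ≤ 1 + w(x)` (`∫ w·a(x, ·) dq ≤ ∫ w dq = 1`;
the rejected mass stays at `x`). [ours] -/
theorem lintegral_weight_indepMH_le [MeasurableSingletonClass Ω] (hw : Measurable w)
    [IsProbabilityMeasure (q.withDensity fun y => ENNReal.ofReal (w y))] (x : Ω) :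
    ∫⁻ y, ENNReal.ofReal (w y) ∂(indepMH q w x) ≤ 1 + ENNReal.ofReal (w x) := by
  haveI : Fact (Measurable w) := ⟨hw⟩
  haveI : IsProbabilityMeasure (indepMH q w x) := IsMarkovKernel.isProbabilityMeasure x
  have h1 : ∫⁻ z, ENNReal.ofReal (w z) ∂q = 1 := by
    have := (measure_univ : (q.withDensity fun y => ENNReal.ofReal (w y)) Set.univ = 1)
    rwa [withDensity_apply _ MeasurableSet.univ, Measure.restrict_univ] at this
  have hsx : ∫⁻ y in {x}, ENNReal.ofReal (w y) ∂(indepMH q w x) ≤ ENNReal.ofReal (w x) := by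
    rw [Measure.restrict_singleton, lintegral_smul_measure, lintegral_dirac' _ hw.ennreal_ofReal, smul_eq_mul]
    exact mul_le_of_le_one_left' prob_le_one
  calc ∫⁻ y, ENNReal.ofReal (w y) ∂(indepMH q w x)
      = ∫⁻ y in {x}ᶜ, ENNReal.ofReal (w y) ∂(indepMH q w x) + ∫⁻ y in {x}, ENNReal.ofReal (w y) ∂(indepMH q w x) := by
        rw [← lintegral_add_compl _ (measurableSet_singleton x), add_comm]
    _ ≤ 1 + ENNReal.ofReal (w x) := add_le_add ((setLIntegral_compl_singleton_indepMH_le hw x hw.ennreal_ofReal).trans h1.le) hsx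

/-- **THE OFF-DIAGONAL PART OF THE PRACTICAL START IS BELOW THE MODEL**: for `ν̂ = K(x, ·)∘(y ↦ (y, x))⁻¹`,
`∫_{Δᶜ} max(1, w(p.1), w(p.2)) dν̂ ≤ max(1, w(x)) + 1` — every positive normalised weight, no moment condition. [ours] -/
theorem lintegral_offDiagonal_detLag_le [MeasurableSingletonClass Ω] [MeasurableEq Ω] (hw : Measurable w) (hw0 : ∀ y, 0 < w y)
    [IsProbabilityMeasure (q.withDensity fun y => ENNReal.ofReal (w y))]
    (x : Ω) (ν : Measure (Ω × Ω)) (hν : ν = (indepMH q w x).map fun y : Ω => (y, x)) :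
    ∫⁻ p in (Set.diagonal Ω)ᶜ, ENNReal.ofReal (max 1 (max (w p.1) (w p.2))) ∂ν ≤ ENNReal.ofReal (max 1 (w x)) + 1 := by
  haveI : Fact (Measurable w) := ⟨hw⟩
  have h1 : ∫⁻ z, ENNReal.ofReal (w z) ∂q = 1 := by
    have := (measure_univ : (q.withDensity fun y => ENNReal.ofReal (w y)) Set.univ = 1)
    rwa [withDensity_apply _ MeasurableSet.univ, Measure.restrict_univ] at this
  have hφ : Measurable fun y : Ω => (y, x) := measurable_id.prodMk measurable_const
  have hD : MeasurableSet (Set.diagonal Ω) := measurableSet_diagonal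
  have hGm : Measurable fun p : Ω × Ω => ENNReal.ofReal (max 1 (max (w p.1) (w p.2))) :=
    (measurable_const.max ((hw.comp measurable_fst).max (hw.comp measurable_snd))).ennreal_ofReal
  have hgm : Measurable fun y : Ω => ENNReal.ofReal (max 1 (max (w y) (w x))) :=
    (measurable_const.max (hw.max measurable_const)).ennreal_ofReal
  have hpre : (fun y : Ω => (y, x)) ⁻¹' (Set.diagonal Ω)ᶜ = ({x}ᶜ : Set Ω) := by
    ext y; simp [Set.mem_diagonal_iff]
  calc ∫⁻ p in (Set.diagonal Ω)ᶜ, ENNReal.ofReal (max 1 (max (w p.1) (w p.2))) ∂ν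
      = ∫⁻ y in {x}ᶜ, ENNReal.ofReal (max 1 (max (w y) (w x))) ∂(indepMH q w x) := by
        rw [hν, setLIntegral_map hD.compl hGm hφ, hpre]
    _ ≤ ∫⁻ y, ENNReal.ofReal (max 1 (max (w y) (w x))) ∂q := setLIntegral_compl_singleton_indepMH_le hw x hgm
    _ ≤ ∫⁻ y, (ENNReal.ofReal (max 1 (w x)) + ENNReal.ofReal (w y)) ∂q := by
        refine lintegral_mono fun y => ?_
        rw [← ENNReal.ofReal_add (le_trans zero_le_one (le_max_left _ _)) (hw0 y).le]
        refine ENNReal.ofReal_le_ofReal (max_le ?_ (max_le ?_ ?_)) <;>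
          linarith [hw0 y, le_max_left (1 : ℝ) (w x), le_max_right (1 : ℝ) (w x)]
    _ = ENNReal.ofReal (max 1 (w x)) + 1 := by
        rw [lintegral_add_left measurable_const, lintegral_const, measure_univ, mul_one, h1]

/-- **THE EXPECTED MEETING TIME FROM A DETERMINISTIC START — EVERY WEIGHT, NO MOMENT CONDITION**: production run at `x`, leading run one
update ahead (initial coupling `ν̂ = K(x, ·) ⊗ δ_x`, i.e. `ν̂ = K(x, ·)∘(y ↦ (y, x))⁻¹`); then
`E[#{n : X_n ≠ X′_n}] ≤ (max(1, w(x)) + 1)/E_q[min(1, w)]` — FINITE FOR EVERY START `x` AND EVERY POSITIVE NORMALISED WEIGHT: the runs differ at time `0` only when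
the leading run MOVED, and the moved mass lies below the model `q`, which integrates `w` by definition. [ours] -/
theorem crn_chain_lintegral_totalDisagreement_le_detLag_unboundedWeights [StandardBorelSpace Ω] [Nonempty Ω]
    [MeasurableSingletonClass Ω] [MeasurableEq Ω] (hw : Measurable w) (hw0 : ∀ y, 0 < w y)
    [IsProbabilityMeasure (q.withDensity fun y => ENNReal.ofReal (w y))]
    (Khat : Kernel (Ω × Ω) (Ω × Ω)) [IsMarkovKernel Khat]
    (hK : ∀ z : Ω × Ω, Khat z = (q.prod (volume : Measure unitInterval)).map (fun p : Ω × unitInterval =>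
      ((if (p.2 : ℝ) * w z.1 ≤ w p.1 then p.1 else z.1), (if (p.2 : ℝ) * w z.2 ≤ w p.1 then p.1 else z.2))))
    (x : Ω) (ν : Measure (Ω × Ω)) [IsProbabilityMeasure ν] (hν : ν = (indepMH q w x).map fun y : Ω => (y, x)) :
    ∫⁻ z, (∑' n, (Set.diagonal Ω)ᶜ.indicator (1 : Ω × Ω → ℝ≥0∞) (z n))
        ∂(Kernel.trajMeasure (X := fun _ : ℕ => Ω × Ω) ν
          (fun n : ℕ => Khat.comap (fun h : (i : ↥(Finset.Iic n)) → Ω × Ω => h ⟨n, Finset.mem_Iic.2 le_rfl⟩)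
            (measurable_pi_apply _))) ≤
      (ENNReal.ofReal (max 1 (w x)) + 1) / ∫⁻ y, ENNReal.ofReal (min 1 (w y)) ∂q := by
  exact (crn_chain_lintegral_totalDisagreement_le_unboundedWeights hw hw0 Khat hK _).trans
    (ENNReal.div_le_div_right (lintegral_offDiagonal_detLag_le hw hw0 x ν hν) _)

end Summit.Ventures.LatticeQCDFlow.Exactness

end
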